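import Summits.ResolutionOfSingularities.ResolutionOfSingularities.Theorems.MarkedTransferCampaignW46MohWindowShadeFormalNRStepPrep
import Literature.AlgebraicGeometry.Resolution.SymbolicPowersRsop
import Mathlib.Algebra.Polynomial.Expand
import Mathlib.FieldTheory.Minpoly.Field
import HarnessLib

/-!
# [OURS · L1 W4.6 rung (iii-2)] INSEPARABLE CHILDREN ARE NEVER IN THE WINDOW: a singular point of the point blow-up of a window germ whose
# residue field is INSEPARABLE over that of the centre is not a window point (ring level, ANY ground field)

Cell `res-hironaka`, LADDER-RESOLUTION rung L (D-0089), slot W4.6 rung (iii); seat res-L1-s46-pv-5 (gen 7). Host route MarkedTransfer,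
`--supports stmt-ResolutionOfSingularities-16155 --as helper`; kind proof (def-free). Plan `HOME/L/res-L1-s46-pv-5/W-WALK-PLAN.md` §7.2 (b): the
FIRST brick of the road map for o1's regime of record `regimeMohWindowSurfaceInsep` over IMPERFECT ground fields (gen 7 closed every PERFECT field,
p576724; there the residue extensions along a thread are separable for free).

WHAT (`false_of_inseparable_child`, pure local algebra; `g : R → L` local between local rings of characteristic `p`, `L` regular of embedding
dimension `3`). Let `c` generate `𝔪_R`, let the point of `L` lie in the chart `u_{i₀}` of the point blow-up (`g(c_j) = g(c_{i₀}) e_j`) on the line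
`z = 0` of the exceptional plane at a NON-RATIONAL point: `𝔪_L = (t, e_z, π̃^g(e_{i₁}))`, `t = g(c_{i₀})`, `π̃ ∈ R[X]` monic with IRREDUCIBLE and
INSEPARABLE reduction `π` (`π′ = 0`). Let the parent carry a window germ read in the chart as `f′ = e_z^p + t^{d−p} · P̃^g(e_{i₁})` with
`p + 1 ≤ d ≤ 2p − 1` and `P̃ ∈ R[X]` of degree `≤ d` with NONZERO reduction (o1's coefficient presentation `z^p + Σ a_i x^{d−i} y^i`, some `a_i` a
unit, gives `P̃ = Σ a_i X^i` in the `x`-chart). THEN `f′` is not singular-in-the-window at the point: `f′ ∈ 𝔪_L^p` together with a window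
presentation `v f′ − w^p ∈ 𝔪_L^{p+1}` (`v` a unit) is contradictory. Proof: `deg π = p · deg ρ ≥ p` (`π = ρ(X^p)`), so `π² ∤ P` (`2p > d`) and,
dividing, `P̃ = π̃ Q̃ + S̃` with `S ≡ 0` (the point is singular, so `P̃^g(e) ∈ 𝔪_L`, and `deg S < deg π = [κ(L) : κ(R)]`-type minimality) and `Q̃^g(e)` a
UNIT; hence `f′ = e_z^p + t^{d−p}(w₀ u + t B)`, `w₀ = π̃^g(e)`, and QUASI-REGULARITY of the regular system of parameters `(t, w₀, e_z)` (tree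
`isQuasiRegular_rsop_comp`, Matsumura 16.2) kills it: for `d ≤ 2p − 2` the form `u T^{d−p} W + B T^{d−p+1}` of degree `< p` would have unit
coefficient `u ∈ 𝔪_L`; for `d = 2p − 1`, writing `w = α t + β w₀ + γ e_z`, `w^p = α^p t^p + β^p w₀^p + γ^p e_z^p` (Frobenius) has no `T^{p−1}W` term,
so `v u ∈ 𝔪_L`. Consequence (road map §7.2): along every thread inside the regime, over ANY ground field, the residue field extensions of
consecutive thread points are separable.

HONEST FRAMING. OURS; nothing here is a statement of H. Hironaka's manuscript [Hironaka2017] and nothing of it is used. AI-written; AI review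
is weaker than expert review. No `sorry`; axioms standard. References: H. Matsumura, *Commutative Ring Theory* (1986) Thm. 16.2 (quasi-regular
sequences) [Matsumura1987]; H. Hauser, Bull. AMS 47 (2010) §§F–G (chart calculus) [Hauser2010]. [folklore]
-/

noncomputable section

set_option linter.dupNamespace false -- mandated namespace of this single-conjunct summit

open IsLocalRing Polynomial

namespace Summit.ResolutionOfSingularities.ResolutionOfSingularities.Theorems

namespace CampaignW46

namespace WWalk

open Literature.AlgebraicGeometry.Resolution
open CampaignW46.MohWindowShadeFormalNR (map_maximalIdeal_pow_le)

section Insep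

variable {p : ℕ} [hp : Fact p.Prime]
  {R : Type} [CommRing R] [IsLocalRing R] [CharP (ResidueField R) p]
  {L : Type} [CommRing L] [IsRegularLocalRing L] [CharP L p]
  (g : R →+* L) (hg : (maximalIdeal R).map g ≤ maximalIdeal L)
  (c : Option (Fin 2) → R) (hc : Ideal.span (Set.range c) = maximalIdeal R)
  {i₀ i₁ : Fin 2} (e : Option (Fin 2) → L) (he : ∀ j, g (c j) = g (c (some i₀)) * e j)
  (πR : R[X]) (hπm : πR.Monic) (hirr : Irreducible (πR.map (residue R)))
  (hgen : Ideal.span {g (c (some i₀)), e none, (πR.map g).eval (e (some i₁))} = maximalIdeal L)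
  (h3 : (maximalIdeal L).spanFinrank = 3)

/-- An inseparable irreducible polynomial over a field of characteristic `p` has degree `≥ p` (`π = ρ(X^p)`). [folklore] -/
theorem le_natDegree_of_derivative_eq_zero {κ : Type*} [Field κ] [CharP κ p] {π : κ[X]} (hirr : Irreducible π)
    (hinsep : Polynomial.derivative π = 0) : p ≤ π.natDegree := by
  have hexp := expand_contract p hinsep hp.out.ne_zero
  have hdeg : π.natDegree = (contract p π).natDegree * p := by
    conv_lhs => rw [← hexp]
    exact natDegree_expand p _
  have hpos : 0 < (contract p π).natDegree := by
    by_contra h0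
    push Not at h0
    have h1 : (contract p π).natDegree = 0 := Nat.le_zero.mp h0
    have : π.natDegree = 0 := by rw [hdeg, h1, zero_mul]
    exact absurd this hirr.natDegree_pos.ne'
  rw [hdeg]
  exact Nat.le_mul_of_pos_left p hpos

include hg hc he hπm hirr hgen h3 in
/-- [OURS · L1 W4.6 rung (iii-2)] **INSEPARABLE CHILDREN ARE NEVER IN THE WINDOW.** See the module docstring. NOT a statement of the
manuscript. [cite: Matsumura1987, Thm. 16.2] [cite: Hauser2010, §§F–G] -/
theorem false_of_inseparable_child (hinsep : Polynomial.derivative (πR.map (residue R)) = 0)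
    (P : R[X]) (hP0 : P.map (residue R) ≠ 0) {d : ℕ} (hPd : P.natDegree ≤ d) (hpd : p + 1 ≤ d) (hd2 : d ≤ 2 * p - 1)
    (f' : L) (hf' : f' = e none ^ p + g (c (some i₀)) ^ (d - p) * (P.map g).eval (e (some i₁)))
    (hsing : f' ∈ maximalIdeal L ^ p)
    (hwin : ∃ v w : L, IsUnit v ∧ v * f' - w ^ p ∈ maximalIdeal L ^ (p + 1)) : False := by
  classical
  set t := g (c (some i₀)) with ht
  set ez := e none with hez
  set ey := e (some i₁) with hey
  set w₀ := (πR.map g).eval ey with hw₀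
  set κ := ResidueField R with hκ
  set π := πR.map (residue R) with hπ
  -- the residue field of `L` over `κ`
  haveI : IsLocalHom g := ((IsLocalRing.local_hom_TFAE g).out 0 2).mpr hg
  set ρ : κ →+* ResidueField L := ResidueField.map g with hρ
  letI : Algebra κ (ResidueField L) := ρ.toAlgebra
  set ybar : ResidueField L := residue L ey with hybar
  -- reading `R`-polynomials at `e_y` modulo `𝔪_L`
  have hres_eval : ∀ T : R[X], residue L ((T.map g).eval ey) = Polynomial.aeval ybar (T.map (residue R)) := fun T => by
    rw [Polynomial.eval_map, Polynomial.hom_eval₂, Polynomial.aeval_def, Polynomial.eval₂_map, hybar]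
    rfl
  -- `π(ȳ) = 0`
  have hw₀𝔪 : w₀ ∈ maximalIdeal L := by rw [← hgen]; exact Ideal.subset_span (by simp [hw₀, hey, ht])
  have haevalπ : Polynomial.aeval ybar π = 0 := by
    rw [hπ, ← hres_eval, residue_eq_zero_iff, ← hw₀]
    exact hw₀𝔪
  have hπmonic : π.Monic := hπm.map _
  have hminpoly : minpoly κ ybar = π := (minpoly.eq_of_irreducible_of_monic hirr haevalπ hπmonic).symm
  have hdegπ : p ≤ π.natDegree := le_natDegree_of_derivative_eq_zero hirr hinsep
  -- division `P = π̃ Q̃ + S̃`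
  set Q := P /ₘ πR with hQ
  set S := P %ₘ πR with hS
  have hPQS : P = πR * Q + S := by rw [hQ, hS]; exact (modByMonic_add_div P πR).symm.trans (add_comm _ _)
  have hSdeg : S.degree < πR.degree := degree_modByMonic_lt P hπm
  -- `t^{d−p} ∉ 𝔪^p`-type facts from quasi-regularity of `(t, w₀, e_z)`
  set x : Fin 3 → L := ![t, w₀, ez] with hx
  have hxspan : Ideal.span (Set.range x) = maximalIdeal L := by
    rw [← hgen]
    congr 1
    ext r
    simp only [Set.mem_range, Set.mem_insert_iff, Set.mem_singleton_iff, hx]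
    constructor
    · rintro ⟨i, rfl⟩
      fin_cases i <;> simp [ht, hez, hw₀, hey]
    · rintro (rfl | rfl | rfl)
      · exact ⟨0, by simp [ht]⟩
      · exact ⟨2, by simp [hez]⟩
      · exact ⟨1, by simp [hw₀, hey]⟩
  have hqr : IsQuasiRegular x := isQuasiRegular_rsop_comp h3 x hxspan id Function.injective_id
  have hqr' := (isQuasiRegular_def x).mp hqr
  have hmemx : ∀ i, x i ∈ maximalIdeal L := fun i => hxspan ▸ Ideal.subset_span ⟨i, rfl⟩
  -- `P̃^g(e_y) ∈ 𝔪_L` (the child is singular)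
  set A := (P.map g).eval ey with hA
  have htdp : ¬ t ^ (d - p) ∈ maximalIdeal L ^ (d - p + 1) := by
    intro hmem
    have hF : (MvPolynomial.monomial (Finsupp.single (0 : Fin 3) (d - p)) (1 : L)).IsHomogeneous (d - p) :=
      MvPolynomial.isHomogeneous_monomial _ (by rw [Finsupp.degree_single])
    have heval : MvPolynomial.eval x (MvPolynomial.monomial (Finsupp.single (0 : Fin 3) (d - p)) (1 : L)) = t ^ (d - p) := by
      rw [MvPolynomial.eval_monomial, one_mul, Finsupp.prod_pow, Fin.prod_univ_three]
      simp [hx]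
    have h1 := hqr' (d - p) _ hF (by rw [heval, hxspan]; exact hmem) (Finsupp.single 0 (d - p))
    rw [MvPolynomial.coeff_monomial, if_pos rfl, hxspan] at h1
    exact (IsLocalRing.mem_maximalIdeal _).mp h1 isUnit_one
  have hA𝔪 : A ∈ maximalIdeal L := by
    by_contra hAu
    have hunit : IsUnit A := (IsLocalRing.notMem_maximalIdeal).mp hAu
    obtain ⟨Au, hAu'⟩ := hunit
    have h1 : t ^ (d - p) * A = f' - ez ^ p := by rw [hf', hA]; ring
    have h2 : t ^ (d - p) * A ∈ maximalIdeal L ^ p := by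
      rw [h1]; exact Ideal.sub_mem _ hsing (Ideal.pow_mem_pow (hmemx 2) p)
    have h3' : t ^ (d - p) ∈ maximalIdeal L ^ p := by
      have := Ideal.mul_mem_right (↑Au⁻¹ : L) _ h2
      rwa [mul_assoc, ← hAu', Units.mul_inv, mul_one] at this
    exact htdp (Ideal.pow_le_pow_right (by omega) h3')
  -- `S ≡ 0`: the reduction of `S̃` vanishes, so `S̃^g(e_y) ∈ 𝔪_R L ⊆ (t)`
  have hS0 : S.map (residue R) = 0 := by
    by_contra hne
    have haevalS : Polynomial.aeval ybar (S.map (residue R)) = 0 := by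
      -- `A = w₀ Q̃^g(e) + S̃^g(e) ∈ 𝔪` and `w₀ ∈ 𝔪`
      have h1 : (S.map g).eval ey ∈ maximalIdeal L := by
        have e1 : (S.map g).eval ey = A - w₀ * (Q.map g).eval ey := by
          rw [hA, hPQS, Polynomial.map_add, Polynomial.map_mul, Polynomial.eval_add, Polynomial.eval_mul, hw₀]; ring
        rw [e1]; exact Ideal.sub_mem _ hA𝔪 (Ideal.mul_mem_right _ _ hw₀𝔪)
      rw [← hres_eval, residue_eq_zero_iff]
      exact h1
    have hle := minpoly.degree_le_of_ne_zero κ ybar hne haevalS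
    rw [hminpoly] at hle
    have hlt : (S.map (residue R)).degree < π.degree := by
      calc (S.map (residue R)).degree ≤ S.degree := degree_map_le
        _ < πR.degree := hSdeg
        _ = π.degree := (hπm.degree_map (residue R)).symm
    exact absurd hle (not_le.mpr hlt)
  have hScoef : ∀ n, S.coeff n ∈ maximalIdeal R := fun n => by
    have := congrArg (fun q => q.coeff n) hS0
    simp only [Polynomial.coeff_map, Polynomial.coeff_zero, residue_eq_zero_iff] at this
    exact this
  obtain ⟨B, hB⟩ : ∃ B : L, (S.map g).eval ey = t * B := by
    have h1 : (S.map g).eval ey ∈ Ideal.span {t ^ 1} := by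
      refine map_maximalIdeal_pow_le c hc g e he 1 ?_
      rw [pow_one, Polynomial.eval_map, Polynomial.eval₂_eq_sum_range]
      refine Ideal.sum_mem _ fun n _ => Ideal.mul_mem_right _ _ (Ideal.mem_map_of_mem g (hScoef n))
    rw [pow_one] at h1
    exact Ideal.mem_span_singleton'.mp h1 |>.imp fun B hB => by rw [← hB, mul_comm]
  -- `Q̃^g(e_y)` is a unit (`π² ∤ P` by degrees)
  set u := (Q.map g).eval ey with hu
  have hunit : IsUnit u := by
    by_contra hnu
    have hu𝔪 : u ∈ maximalIdeal L := (IsLocalRing.mem_maximalIdeal _).mpr hnu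
    have haevalQ : Polynomial.aeval ybar (Q.map (residue R)) = 0 := by
      rw [← hres_eval, residue_eq_zero_iff]
      exact hu𝔪
    have hdvd : π ∣ Q.map (residue R) := by rw [← hminpoly]; exact minpoly.dvd κ ybar haevalQ
    -- `π² ∣ P`, degree `≥ 2p > d ≥ deg P`
    have hP : P.map (residue R) = π * Q.map (residue R) := by
      rw [hPQS, Polynomial.map_add, Polynomial.map_mul, hS0, add_zero]
    obtain ⟨Q₁, hQ₁⟩ := hdvd
    have hQ₁0 : Q₁ ≠ 0 := by
      rintro rfl; rw [mul_zero] at hQ₁; rw [hQ₁, mul_zero] at hP; exact hP0 hP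
    have hπ0 : π ≠ 0 := hirr.ne_zero
    have hdeg1 : (P.map (residue R)).natDegree = π.natDegree + π.natDegree + Q₁.natDegree := by
      rw [hP, hQ₁, ← mul_assoc, Polynomial.natDegree_mul (mul_ne_zero hπ0 hπ0) hQ₁0, Polynomial.natDegree_mul hπ0 hπ0]
    have hdeg2 : (P.map (residue R)).natDegree ≤ d := (natDegree_map_le).trans hPd
    omega
  -- `f' = e_z^p + t^{d−p} (w₀ u + t B)`
  have hAeq : A = w₀ * u + t * B := by
    rw [hA, hPQS, Polynomial.map_add, Polynomial.map_mul, Polynomial.eval_add, Polynomial.eval_mul, ← hw₀, ← hu, hB]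
  have hf'eq : f' = ez ^ p + t ^ (d - p) * (w₀ * u + t * B) := by rw [hf', hAeq]
  -- the two quasi-regularity contradictions
  by_cases hd : d = 2 * p - 1
  · -- window: `v f' − w^p ∈ 𝔪^{p+1}`
    obtain ⟨v, w, hv, hvw⟩ := hwin
    have hw𝔪 : w ∈ maximalIdeal L := by
      by_contra hwu
      have hwunit : IsUnit (w ^ p) := ((IsLocalRing.notMem_maximalIdeal).mp hwu).pow p
      have h1 : v * f' ∈ maximalIdeal L := Ideal.mul_mem_left _ _ (Ideal.pow_le_self hp.out.ne_zero hsing)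
      have h2 : w ^ p ∈ maximalIdeal L := by
        have := Ideal.sub_mem _ h1 (Ideal.pow_le_self (by omega) hvw); rwa [sub_sub_cancel] at this
      exact (IsLocalRing.mem_maximalIdeal _).mp h2 hwunit
    rw [← hxspan] at hw𝔪
    obtain ⟨α, β, γ, hw⟩ : ∃ α β γ : L, w = α * t + β * w₀ + γ * ez := by
      have : Set.range x = {t, w₀, ez} := by
        ext r; simp only [Set.mem_range, Set.mem_insert_iff, Set.mem_singleton_iff, hx]
        constructor
        · rintro ⟨i, rfl⟩; fin_cases i <;> simp
        · rintro (rfl | rfl | rfl)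
          · exact ⟨0, by simp⟩
          · exact ⟨1, by simp⟩
          · exact ⟨2, by simp⟩
      rw [this] at hw𝔪
      obtain ⟨α, r, hr, hαr⟩ := Ideal.mem_span_insert.mp hw𝔪
      obtain ⟨β, s, hs, hβs⟩ := Ideal.mem_span_insert.mp hr
      obtain ⟨γ, hγ⟩ := Ideal.mem_span_singleton'.mp hs
      exact ⟨α, β, γ, by rw [hαr, hβs, ← hγ, add_assoc]⟩
    have hdp : d - p = p - 1 := by omega
    -- the form `F = (v − γ^p) Z^p + (v u) T^{p−1} W + (v B − α^p) T^p − β^p W^p`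
    set m₁ : Fin 3 →₀ ℕ := Finsupp.single 0 (p - 1) + Finsupp.single 1 1 with hm₁
    set F : MvPolynomial (Fin 3) L := MvPolynomial.monomial (Finsupp.single 2 p) (v - γ ^ p) + MvPolynomial.monomial m₁ (v * u) +
      MvPolynomial.monomial (Finsupp.single 0 p) (v * B - α ^ p) - MvPolynomial.monomial (Finsupp.single 1 p) (β ^ p) with hF
    have hFhom : F.IsHomogeneous p := by
      refine ((MvPolynomial.isHomogeneous_monomial _ ?_).add (MvPolynomial.isHomogeneous_monomial _ ?_)).add
        (MvPolynomial.isHomogeneous_monomial _ ?_) |>.sub (MvPolynomial.isHomogeneous_monomial _ ?_)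
      · rw [Finsupp.degree_single]
      · rw [hm₁, map_add, Finsupp.degree_single, Finsupp.degree_single]; have := hp.out.one_lt; omega
      · rw [Finsupp.degree_single]
      · rw [Finsupp.degree_single]
    have hFeval : MvPolynomial.eval x F = v * f' - w ^ p := by
      have e1 : w ^ p = α ^ p * t ^ p + β ^ p * w₀ ^ p + γ ^ p * ez ^ p := by
        rw [hw, add_pow_char, add_pow_char, mul_pow, mul_pow, mul_pow]
      have hp1 : p - 1 + 1 = p := by have := hp.out.one_lt; omega
      rw [hF, map_sub, map_add, map_add, MvPolynomial.eval_monomial, MvPolynomial.eval_monomial, MvPolynomial.eval_monomial,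
        MvPolynomial.eval_monomial, Finsupp.prod_pow, Finsupp.prod_pow, Finsupp.prod_pow, Finsupp.prod_pow, Fin.prod_univ_three,
        Fin.prod_univ_three, Fin.prod_univ_three, Fin.prod_univ_three, hf'eq, hdp, e1]
      simp only [hm₁, hx, Finsupp.coe_add, Pi.add_apply, Finsupp.single_apply, Matrix.cons_val_zero, Matrix.cons_val_one,
        Matrix.cons_val_two, Matrix.head_cons, Matrix.tail_cons]
      simp only [Fin.isValue, Fin.reduceEq, if_true, if_false, add_zero, zero_add, pow_zero, pow_one, mul_one, one_mul]
      rw [show t ^ (p - 1) * (w₀ * u + t * B) = t ^ (p - 1) * w₀ * u + t ^ p * B by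
        rw [mul_add, ← mul_assoc, ← mul_assoc, ← pow_succ, hp1]]
      ring
    have hcoef := hqr' p F hFhom (by rw [hFeval, hxspan]; exact hvw) m₁
    have hm₁F : F.coeff m₁ = v * u := by
      have h20 : Finsupp.single (2 : Fin 3) p ≠ m₁ := by
        intro h; have := congrArg (fun f => f 2) h; simp [hm₁] at this; exact hp.out.ne_zero this
      have h00 : Finsupp.single (0 : Fin 3) p ≠ m₁ := by
        intro h; have := congrArg (fun f => f 1) h; simp [hm₁] at this
      have h10 : Finsupp.single (1 : Fin 3) p ≠ m₁ := by
        intro h; have := congrArg (fun f => f 1) h; simp [hm₁] at this; have := hp.out.one_lt; omega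
      rw [hF, MvPolynomial.coeff_sub, MvPolynomial.coeff_add, MvPolynomial.coeff_add, MvPolynomial.coeff_monomial, MvPolynomial.coeff_monomial,
        MvPolynomial.coeff_monomial, MvPolynomial.coeff_monomial, if_neg h20, if_pos rfl, if_neg h00, if_neg h10]
      ring
    rw [hm₁F, hxspan] at hcoef
    exact (IsLocalRing.mem_maximalIdeal _).mp hcoef (hv.mul hunit)
  · -- `d ≤ 2p − 2`: the form `u T^{d−p} W + B T^{d−p+1}` of degree `d − p + 1 < p`
    have hδ : d - p + 1 ≤ p - 1 := by omega
    set m₁ : Fin 3 →₀ ℕ := Finsupp.single 0 (d - p) + Finsupp.single 1 1 with hm₁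
    set F : MvPolynomial (Fin 3) L := MvPolynomial.monomial m₁ u + MvPolynomial.monomial (Finsupp.single 0 (d - p + 1)) B with hF
    have hFhom : F.IsHomogeneous (d - p + 1) := by
      refine (MvPolynomial.isHomogeneous_monomial _ ?_).add (MvPolynomial.isHomogeneous_monomial _ ?_)
      · rw [hm₁, map_add, Finsupp.degree_single, Finsupp.degree_single]
      · rw [Finsupp.degree_single]
    have hFeval : MvPolynomial.eval x F = f' - ez ^ p := by
      rw [hF, map_add, MvPolynomial.eval_monomial, MvPolynomial.eval_monomial, Finsupp.prod_pow, Finsupp.prod_pow, Fin.prod_univ_three,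
        Fin.prod_univ_three, hf'eq]
      simp only [hm₁, hx, Finsupp.coe_add, Pi.add_apply, Finsupp.single_apply, Matrix.cons_val_zero, Matrix.cons_val_one,
        Matrix.cons_val_two, Matrix.head_cons, Matrix.tail_cons]
      simp only [Fin.isValue, Fin.reduceEq, if_true, if_false, add_zero, zero_add, pow_zero, pow_one, mul_one]
      rw [pow_succ]
      ring
    have hmem : MvPolynomial.eval x F ∈ Ideal.span (Set.range x) ^ (d - p + 1 + 1) := by
      rw [hFeval, hxspan]
      exact Ideal.pow_le_pow_right (by omega) (Ideal.sub_mem _ hsing (Ideal.pow_mem_pow (hmemx 2) p))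
    have hcoef := hqr' (d - p + 1) F hFhom hmem m₁
    have hm₁F : F.coeff m₁ = u := by
      have h00 : Finsupp.single (0 : Fin 3) (d - p + 1) ≠ m₁ := by
        intro h; have := congrArg (fun f => f 1) h; simp [hm₁] at this
      rw [hF, MvPolynomial.coeff_add, MvPolynomial.coeff_monomial, MvPolynomial.coeff_monomial, if_pos rfl, if_neg h00, add_zero]
    rw [hm₁F, hxspan] at hcoef
    exact (IsLocalRing.mem_maximalIdeal _).mp hcoef hunit

end Insep

end WWalk

end CampaignW46

end Summit.ResolutionOfSingularities.ResolutionOfSingularities.Theorems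

end
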